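import Summits.NavierStokesRegularity.NavierStokesRegularity.Theses.SqueezeCycle
import Summits.NavierStokesRegularity.NavierStokesRegularity.Theorems.RecurrentProfilesRecurrentReduction
import Summits.NavierStokesRegularity.NavierStokesRegularity.Theorems.RellichScarApexLocalisationSmallRateRegularity
import Summits.NavierStokesRegularity.NavierStokesRegularity.Theorems.RellichScarTypeIBlowupProfile
import Summits.NavierStokesRegularity.NavierStokesRegularity.Theorems.RecurrentLiouville.Negative.FalseWithoutNavierStokes
import Summits.NavierStokesRegularity.NavierStokesRegularity.Theorems.SqueezeCycleRecurrentLiouvilleNearIdentityDSS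
import Summits.NavierStokesRegularity.NavierStokesRegularity.Theorems.SqueezeCycleRecurrentLiouvilleNearAxisymmetricRemoval
import Summits.NavierStokesRegularity.NavierStokesRegularity.Theorems.SqueezeCycleRecurrentLiouvilleSmallHullRemoval
import Summits.NavierStokesRegularity.NavierStokesRegularity.Theorems.SqueezeCycleExtremalBiaxialitySubcriticalSmallConstant
import Summits.NavierStokesRegularity.NavierStokesRegularity.Theorems.SqueezeCycleExtremalElementExistsRegularity
import Literature.Analysis.FluidPDE.TypeIRateOseenMildRepresentative
import Literature.Analysis.FluidPDE.LocalTypeILiouville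
import Literature.Analysis.FluidPDE.ParasiticSlabFlow
import Literature.Analysis.FluidPDE.KinematicApexWitness
import Literature.Analysis.FluidPDE.ScalingUniformRecurrence

/-!
# Disproof of `RecurrentLiouville` — findings (cdisprove, crux stmt-NavierStokesRegularity-1589; gen 1 cycle 1, gen 2 cycle 1)

Standing disprover's work file for the crux `SqueezeCycle.RecurrentLiouville`
(= `RecurrentProfiles.RecurrentLiouville` letter for letter, §0; shared by routes RecurrentProfiles
and SqueezeCycle): *every suitable weak solution `(u,p)` of Navier–Stokes (`ν = 1`, `f = 0`) on
the backward slab `(-∞,0) × ℝ³` with weak gradient `G`, Albritton–Barker `𝐈 = typeIBound(slab)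
< ⊤`, Type-I rate `‖u(t,x)‖ ≤ C/√(−t)` and UNIFORMLY RECURRENT under the scaling flow
`σ ↦ nsRescale (e^σ)` in `L³_loc({t ≤ 0} × ℝ³)` is regular at the space–time origin.*

VERDICT (gen 1 and gen 2): **no kill**. The statement is faithful (no junk: §A2, §0) and is
EXACTLY as hard as the Type-I Liouville problem on the Albritton–Barker class (§A3): its
counterexamples are precisely the Type-I singularity models (recurrent or not), none of which is
known to exist (backward `λ`-DSS/RDSS with the rate = Bradshaw–Tsai OP 5.1 / Tsai's conjecture;
`α ≈ 1` RSS = Pineau–Vicol 2026 Conj. 1.1 middle range; aperiodic minimal sets: nothing in print).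
GEN 2 adds: the picked line's residual stub S5 is the crux again (§E1, theorem), the Branch
lemmas' class hypotheses are load-bearing only through the two junk witnesses of §A (§E2), and a
typed PORTRAIT of any counterexample assembled from the tree's proved exclusions (§F).

## Findings (theorems below unless marked PROSE)

* §0  `routes_agree`, `recurrentLiouville_iff_literature` — the two route copies agree
      (`Iff.rfl`); the recurrence clause IS the Literature predicate
      `IsScalingUniformlyRecurrent` (`Iff.rfl`), so its API (`.nsRescale`, `.congr_ae`,
      `.exists_le/.exists_ge`, Birkhoff bridge) applies verbatim.
* §A  LOAD-BEARING ANALYSIS (one hypothesis dropped at a time):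
  - A1 `recurrentLiouville_false_without_typeIBound` — `𝐈 < ⊤` IS load-bearing: the parasitic
       slab flow `u = (1/√(−t)) e₀` (KNSS 2009 §1; tree `ParasiticSlabFlow`) is suitable weak,
       has the rate, is self-similar (hence uniformly recurrent) and origin-singular; it has
       `𝐈 = ⊤` (`parasitic_typeIBound_eq_top`) so it misses the crux.  LANDING:
       `Theorems/RecurrentLiouville/Negative/FalseWithoutTypeIBound.lean` (gen 1 p115683 bounced
       on a duplicate sanity lemma only; gen 2 re-filed p119475, ACCEPTED).
  - A2 `recurrentLiouville_false_without_navierStokes` — the EQUATIONS are load-bearing and the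
       crux is not a kinematic triviality: the self-similar bump `χ(‖x‖²/(−t))/√(−t) e₀`
       (tree `KinematicApexWitness`) has weak gradient, `𝐈 < ⊤`, the rate, is uniformly
       recurrent and origin-singular. So `typeIBound`, `HasTypeITimeDecay`, the recurrence clause
       and `IsBackwardSingularPoint` carry no junk making the crux vacuous or trivially false.
       LANDED: `…/Negative/FalseWithoutNavierStokes.lean` (p115695 ACCEPTED; imported here).
  - A3 `withoutRecurrence_false_iff`, `recurrentLiouville_false_iff_typeISingularProfileExists` —
       the RECURRENCE clause is NOT load-bearing: by the PROVED reduction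
       `recurrentReduction_proof` (item 1590) the crux and the crux-without-recurrence
       (= `RecurrentProfiles.NoTypeIRateProfile` verbatim) have the same counterexamples.
       KILL CRITERION: `¬ crux ↔ ∃` Type-I singularity model of the A–B class; physical form
       `typeISingularProfileExists_of_typeIBlowup`: any Type-I-rate blow-up of a finite-energy
       classical solution from a rapidly decaying datum (via the PROVED `typeIBlowupProfile_proof`,
       item 1591) is such a model. Consequence for provers: recurrence is a free normalisation
       (WLOG), it gives structure (minimal set, invariant measures) but never smallness or sign.
       LANDED: `…/Negative/KillCriterion.lean` (p116351, ACCEPTED).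
  - A4 (PROSE, `RecurrentLiouvilleWithoutRate`) dropping the RATE leaves "recurrent `𝐈 < ⊤`
       ancient suitable solutions are regular" — no witness known either way (a singular
       suitable weak solution of unforced NS with `𝐈 < ⊤` is unknown; SS ones are excluded by
       Tsai 1998 Thm 2 without any rate). Not separable.
  - A5 (PROSE, `RecurrentLiouvilleWithoutWeakGradient`) decoupling `G` from `u` only frees the
       `E`-term of `𝐈`; every known witness is still excluded by `A = ⊤` (parasitic) or by the
       equations (bump). Not separable.
* §B  SETTLED REGIMES (positive, for orientation; a counterexample must avoid all of them):
  - B1 `regular_of_rate_nonpos` — `C ≤ 0` forces `u = 0` on `t < 0`: WLOG `C > 0`.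
  - B2 `smallRate_regime` — for every `I < ⊤` there is `η(I) > 0` such that the crux holds for
       all class profiles with `𝐈 ≤ I` and `C ≤ η` (tree `stub_smallRateRegularity`,
       ε-regularity in rate form): a counterexample needs `C > η(𝐈(u))`.
  - B2′ (gen 2) `exists_universal_rate_floor_ae_zero`, `exists_universal_rate_floor` — a UNIVERSAL
       `ε > 0` (no `𝐈`-dependence): class members with `C ≤ ε` vanish a.e. on the slab (A–B's
       continuous Oseen-mild representative + KNSS Prop. 4.1 bridge + the tree's halving lemma
       `exists_typeIAncientMild_eq_zero_of_small` = Leray's lower rate bound in ancient form); so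
       EVERY counterexample has `C > ε`, whatever its `𝐈`. LANDING with §F in
       `…/Negative/CounterexamplePortrait.lean` (p119983, ACCEPTED).
  - B3 (PROSE) fixed points of the flow (self-similar profiles): none (NRŠ 1996 Thm 1, Tsai 1998
       Thm 2 in the local-energy class; tree `tsai_selfsimilar_local_energy_holds`);
       axisymmetric: none (Seregin–Šverák 2009; tree `AxisymmetricTypeIExclusion`). UNDER THE
       STRONGER APEX BOUND `|u| ≤ C/(|x| + √(−t))` (`HasTypeIDecay`, which the crux's class does NOT
       grant — cf. crux card `satellite-exclusion-dark-profiles`, a `λ`-DSS class member may carry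
       satellites `λᵏx₁`): `λ`-DSS with `λ ∈ (1, λ_*(C))`: none (Chae–Wolf 2017 Thm 1.3, held
       arXiv:1610.09464); RSS with `|α| < α_(C)` or `|α| > ᾱ(C)`: none, `α ≈ 1` OPEN (Pineau–Vicol
       2026 = arXiv:2607.09619, Thm 1.4 and Conj. 1.1, read p. 4; Thms 1.6–1.7 for near-identity
       (R)DSS). GEN 2: inside the crux's OWN class (time rate only, a.e. DSS, suitable weak) the
       near-identity window is now a TREE THEOREM (`stub_rlNearIdentityDSS`, p118437) and so is the
       open axisymmetric rung (`stub_rlNearAxisymmetricRemoval`, p118302) — both used in §F.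
       SqueezeCycle's proved floors are typed constraints on any smooth counterexample:
       `sup Λ > 1/4` (`mustSqueezeAt_quarter`), `sup (−t)λ₁ ≥ 1` (p94840), `sup` Ky Fan `≥ 1/2`
       (p95491).
* §C  NATURAL STRENGTHENINGS: C1 (PROSE) "conclusion pointwise `u ≡ 0` on `t<0`" is false for a
      junk reason (null-set modification at `x = 0` with the rate kept) — irrelevant, the crux's
      conclusion is essential (`L^∞`); C2 the uniform-in-class version (a radius `r(C, I)` of
      regularity) is expected to follow from the crux by compactness + persistence (A–B Lemma 2.2,
      Prop. 2.3, as in `stub_smallRateRegularity`) — PROSE, not a genuine strengthening. C3 (gen 2,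
      PROSE) NO natural strengthening whose conclusion is implied by `u = 0` can be refuted inside
      the class at present: every explicitly known member of the class {suitable weak ancient,
      `𝐈 < ⊤`, rate} is TRIVIAL (small `C`: B2 + Duhamel; SS: Tsai; DSS near 1: p118437;
      axisymmetric: Seregin–Šverák; 2D-like/shear: caloric, killed by the rate via the maximum
      principle) — the class is conjecturally `{0}` (KNSS/Seregin–Šverák (L), items 0057/4050), so
      refutations of strengthenings can only come from the two junk directions of §A (drop `𝐈 < ⊤`
      or drop the equations), which is what §E2 does for the line's Branch lemmas.
* §D  BARRIERS bearing on PROOFS (catalogue `Literature/Barriers/NavierStokesRegularity`; D1 TYPED as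
      `IsNSIProfileOnSlab` / `RecurrentLiouvilleForNSI`, its falsity PROSE):
  - D1 `NavierStokesInequalitySingularSolution(Narrow)` + `SchefferSwitchedScaleInvariance`:
       Scheffer's switched field is a weak solution of the Navier–Stokes INEQUALITY which is
       DISCRETELY SELF-SIMILAR about its singular apex with the Type-I rate in time and space
       (tree: `IsNSIBlock.norm_glue_le_div_sqrt`, `norm_sub_mul_norm_glue_le`,
       `not_isRegularPoint_glue`). Its two-sided (`j ∈ ℤ`) glue — formally covariant, NOT in tree —
       is an ancient `τ⁻¹`-DSS (periodic orbit ⇒ uniformly recurrent) origin-singular field with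
       the rate and (by DSS-invariance of `𝐈` and compact slices) `𝐈 < ⊤`, satisfying every clause
       of `IsSuitableWeakSolutionOn` EXCEPT the momentum equation in `𝒟'`. HENCE (modulo that
       routine extension) no lever using only energy class + incompressibility + pressure formula
       + local energy inequality + rate + recurrence can prove the crux: the route's tools (a)
       semi-Lyapunov local-energy functionals and (b) Krylov–Bogoliubov averages of the local
       energy INEQUALITY are barred as stand-alone levers; the equation itself (vorticity
       transport, backward uniqueness, local energy EQUALITY, the `∂ₛP` coupling) must enter.
       The same NSI-DSS object sits INSIDE S5's residual core (it is `τ⁻¹`-DSS with `τ⁻¹` large,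
       far from the near-identity window, not near-axisymmetric), so it bars LEI-only proofs of S5
       as well.
  - D2 `EnergySupercriticality`: recurrence gives neither smallness nor sign (route file concedes).
  - D3 `TaoAveragedBlowup`: Tao's blow-up is Type II — no counterexample here, but an abstract
       bilinear-estimate proof would transfer to averaged NS.
* §E  LINE SKETCH (rung-neighbourhoods; lead prover-line-stmt-NavierStokesRegularity-1589-0;
      stubs S1–S4, S6, S7, C1–C3 and SHR (p117043) ACCEPTED, C4 bounced on dedup only,
      S5 `stub_rlResidualCore` STUCK). TARGETS = S5.
  - E1 `residualCore_false_iff` (modulo Branch A) and `residualCore_false_iff_crux_false`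
       (UNCONDITIONAL, Branch A = `stub_rlSmallHullRemoval` landed): `¬ S5 ↔ ¬ crux`
       (`↔ TypeISingularProfileExists`). LANDED p119748 + unconditional corollary p120057 (both ACCEPTED). S5 is the crux
       restated, not reduced: `residualCore_of_crux` (S5 is a special case) and
       `not_residualCore_of_typeISingularProfileExists` (a singularity model, made recurrent by
       item 1590 and placed at level `M = 𝐈(w)`, has a non-`δ(C,M)`-small orbit by Branch A itself,
       so it meets every hypothesis of S5). VERDICT for the lead: `promote-stub` is right; no stub
       of this line is false; nothing cheaper than a Type-I singularity model kills S5.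
  - E2 junk load-bearing of the Branch lemmas: `smallHullsRemovable_top_false`,
       `smallHullRemoval_false_without_finiteBound`, `nearIdentityDSS_false_without_finiteBound`
       (parasitic flow: orbit diameter `0`, `λ`-DSS for every `λ`, singular, `𝐈 = ⊤`) and
       `smallHullRemoval_false_without_navierStokes` (bump, at the finite level `M = 𝐈(bump)`):
       `𝐈 ≤ M < ⊤` and the equations are used essentially by Branches A/A′; nothing else is
       separable (same reason as §C3).
  - E3 (PROSE) JOINT SUFFICIENCY: `RecurrentLiouville_of` = SHR(C, 𝐈(u)) + case split on the orbit
       diameter + S5 is pure logic (skeleton-checked); no gap is smuggled — the gap IS S5.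
  - E4 (PROSE) why rung-neighbourhood lines cannot converge on the crux: the singular set
       `Sing(C,M) ⊆ 𝒮(C,M)` is compact in `L³_loc` and scaling/rotation invariant (A–B Prop. 2.3 +
       `stub_rlClassLimit`); for ANY closed invariant rung `R` with `R ∩ Sing = ∅` PROVED, the
       "`δ(C,M)`-neighbourhood of `R` is regular" lemma follows by compactness alone and the
       residual "`𝒮 ∖ N_δ(R)` regular" is crux-complete by the propositional identity
       `crux ↔ (R-part) ∧ (residual)`. Progress on the crux itself needs a rung family that
       EXHAUSTS the recurrent minimal sets — i.e. new exclusions (large-`λ` DSS, `α ≈ 1` RSS,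
       aperiodic minimal sets), each of which is an open problem of the field.
* §F  PORTRAIT `counterexample_portrait` (+ `orbit_not_small_of_singular` modulo Branch A): any
      counterexample `(u,p,G,C)` has `C > η(𝐈(u)) > 0`, is not a.e. `λ`-DSS for
      `λ ∈ (1, Λ(C,𝐈(u)))` (so not self-similar), is `δ(C,𝐈(u))`-far in `L³(Q(0,2))` from every
      field with axisymmetric slices, has a uniformly recurrent singular sibling, and (mod Branch
      A, now landed — `orbit_not_small_of_singular'` unconditional) a scaling orbit of
      `L³(Q(0,1))`-diameter `> δ(C,𝐈(u))`. Every clause is a tree theorem. LANDING: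
      `…/Negative/CounterexamplePortrait.lean` (p119983, ACCEPTED; B2′ + clauses 1–4).
* §G  NEAR-MISSES: none. Cheapest conceivable kills (all research-scale, none attempted as compute):
      numerical continuation of backward RSS profiles in `α` from the Pineau–Vicol large-`α` regime
      hunting a fold (ideator B3), or backward-DSS from Bradshaw–Tsai forward-DSS data by sign
      reversal; a certified profile would still have to be turned into a suitable weak solution
      with `𝐈 < ⊤` (interval arithmetic on an unbounded 3D domain) — years, not sessions.
      LITERATURE WATCH (gen 2, Semantic Scholar sweep 2024–2026; local index and OpenAlex down):
      no credible construction of a Type-I / backward-DSS singularity. arXiv:2604.09949 (2026,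
      "Stable finite-time singularity for 3D NS via 5D-lifted axisymmetric reductions", a
      computer-assisted claim of a NEARLY SELF-SIMILAR AXISYMMETRIC blow-up on `𝕋³` for `ν < ν_c`)
      would be a Type-I axisymmetric singularity and so contradicts Seregin–Šverák 2009 Thm 1.1
      (tree: `axisymmetricTypeIExclusion_of_tree`, `knss_no_axisymmetric_typeI_holds`); the
      manuscript cites none of KNSS 2009 / Seregin–Šverák / NRŠ / Tsai — NOT CREDIBLE, not pursued.
      arXiv:2607.12159 (Binz–Coiculescu 2026) concerns FORWARD self-similar profiles (non-uniqueness
      programme) — irrelevant to backward singular models. Pineau–Vicol 2026 (arXiv:2607.09619)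
      remains the frontier on the RSS rung.

All theorems here are sorry-free; prose claims are marked PROSE.
-/

noncomputable section

open MeasureTheory TopologicalSpace Set Function Filter Topology Metric
open scoped InnerProductSpace RealInnerProductSpace ENNReal NNReal Laplacian
open Literature.Analysis.FluidPDE
open Summit.NavierStokesRegularity.NavierStokesRegularity.Theses
open Summit.NavierStokesRegularity.NavierStokesRegularity.Theorems

set_option linter.dupNamespace false

namespace Summit.NavierStokesRegularity.NavierStokesRegularity.Cruxes.RecurrentLiouville.Disproof

/-- Physical space. -/
local notation "ℝ³" => EuclideanSpace ℝ (Fin 3)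

/-- The open backward slab `(-∞,0) × ℝ³` (time first), as in the route file. -/
local notation "𝕊" => Literature.Analysis.FluidPDE.slab (EuclideanSpace ℝ (Fin 3)) (Set.Iio (0 : ℝ)) isOpen_Iio

/-- `L³` on the unit backward cylinder `Q(0,1)` — the metric of line Sketch (Branch A, S5). -/
local notation "μ₁" => (volume.restrict (parabolicCylinder 1 (0 : ℝ × EuclideanSpace ℝ (Fin 3))) :
  Measure (ℝ × EuclideanSpace ℝ (Fin 3)))

/-- `L³` on `Q(0,2)` — the metric of Branch C. -/
local notation "μ₂" => (volume.restrict (parabolicCylinder 2 (0 : ℝ × EuclideanSpace ℝ (Fin 3))) :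
  Measure (ℝ × EuclideanSpace ℝ (Fin 3)))

/-! ## §0 The statement, read back -/

/-- The two route copies of the crux agree letter for letter. -/
theorem routes_agree : SqueezeCycle.RecurrentLiouville ↔ RecurrentProfiles.RecurrentLiouville :=
  Iff.rfl

/-- The recurrence clause of the crux IS the Literature predicate `IsScalingUniformlyRecurrent`
(definition request of route RecurrentProfiles, stated letter for letter), so the crux reads:
class profile ∧ `IsScalingUniformlyRecurrent u` ⇒ origin regular. -/
theorem recurrentLiouville_iff_literature :
    SqueezeCycle.RecurrentLiouville ↔
      ∀ (u : ℝ → ℝ³ → ℝ³) (p : ℝ → ℝ³ → ℝ) (G : ℝ → ℝ³ → ℝ³ →L[ℝ] ℝ³) (C : ℝ),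
        IsSuitableWeakSolutionOn 𝕊 1 0 u p → HasWeakSpatialGradientOn 𝕊 u G →
        typeIBound (Set.Iio (0 : ℝ) ×ˢ Set.univ) u p G < ⊤ → HasTypeITimeDecay C u →
        IsScalingUniformlyRecurrent u → ¬ IsBackwardSingularPoint u 0 :=
  Iff.rfl

/-! ## §A Load-bearing analysis -/

/-! ### A1 — `𝐈 < ⊤` is load-bearing (parasitic slab flow) -/

/-- The crux with `typeIBound … < ⊤` DROPPED. -/
def RecurrentLiouvilleWithoutTypeIBound : Prop :=
  ∀ (u : ℝ → ℝ³ → ℝ³) (p : ℝ → ℝ³ → ℝ) (G : ℝ → ℝ³ → ℝ³ →L[ℝ] ℝ³) (C : ℝ),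
    IsSuitableWeakSolutionOn 𝕊 1 0 u p → HasWeakSpatialGradientOn 𝕊 u G →
    HasTypeITimeDecay C u → IsScalingUniformlyRecurrent u → ¬ IsBackwardSingularPoint u 0

/-- The parasitic flow is a fixed point of the scaling flow, hence uniformly recurrent. -/
theorem parasitic_isScalingUniformlyRecurrent (C : ℝ) :
    IsScalingUniformlyRecurrent (parasiticVelocity C) :=
  IsSelfSimilar.isScalingUniformlyRecurrent fun _ hc => parasitic_nsRescale C hc

/-- **A1.** `𝐈 < ⊤` is load-bearing: without it the crux is false (parasitic flow, `C = 1`).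
[cite: KNSS2009, §1 p. 3] -/
theorem recurrentLiouville_false_without_typeIBound : ¬ RecurrentLiouvilleWithoutTypeIBound :=
  fun h => h _ _ _ 1 (parasitic_isSuitableWeakSolutionOn 1) (parasitic_hasWeakSpatialGradientOn 1)
    (parasitic_hasTypeITimeDecay zero_le_one) (parasitic_isScalingUniformlyRecurrent 1)
    (parasitic_isBackwardSingularPoint_zero one_pos)

/-- ... and the witness violates exactly the dropped clause (`𝐈 = ⊤` for every `p`, `G`), so it
does not touch the crux. [cite: AlbrittonBarker2019, §1] -/
theorem parasitic_misses_crux (p : ℝ → ℝ³ → ℝ) (G : ℝ → ℝ³ → ℝ³ →L[ℝ] ℝ³) :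
    ¬ typeIBound (Set.Iio (0 : ℝ) ×ˢ Set.univ) (parasiticVelocity 1) p G < ⊤ := by
  rw [parasitic_typeIBound_eq_top one_pos p G]
  exact lt_irrefl _

/-! ### A2 — the Navier–Stokes equations are load-bearing (kinematic bump with `𝐈 < ⊤`) -/

/-- The kinematic bump is uniformly recurrent under scaling: it is exactly backward self-similar
(LANDED as `RecurrentLiouville.Negative.apex_nsRescale` / `apex_isSelfSimilar`, p115695). -/
theorem apex_isScalingUniformlyRecurrent : IsScalingUniformlyRecurrent ParabolicBump.apexVelocity :=
  RecurrentLiouville.Negative.apex_isSelfSimilar.isScalingUniformlyRecurrent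

/-- The crux with `IsSuitableWeakSolutionOn` DROPPED. -/
def RecurrentLiouvilleWithoutNavierStokes : Prop :=
  ∀ (u : ℝ → ℝ³ → ℝ³) (p : ℝ → ℝ³ → ℝ) (G : ℝ → ℝ³ → ℝ³ →L[ℝ] ℝ³) (C : ℝ),
    HasWeakSpatialGradientOn 𝕊 u G → typeIBound (Set.Iio (0 : ℝ) ×ˢ Set.univ) u p G < ⊤ →
    HasTypeITimeDecay C u → IsScalingUniformlyRecurrent u → ¬ IsBackwardSingularPoint u 0

/-- **A2.** The equations are load-bearing: without them the crux is false (bump, `p = 0`,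
`G = apexGradient`, `C = 1`). The function classes of the crux are consistent with an origin
singularity; the statement is dynamical. LANDED (verbatim-clause form):
`RecurrentLiouville.Negative.recurrentLiouville_false_without_navierStokes` (p115695, ACCEPTED).
[cite: AlbrittonBarker2019, §1] -/
theorem recurrentLiouville_false_without_navierStokes : ¬ RecurrentLiouvilleWithoutNavierStokes :=
  fun h => h _ 0 _ 1 ParabolicBump.apex_hasWeakSpatialGradientOn ParabolicBump.typeIBound_apex_lt_top
    ParabolicBump.apex_hasTypeITimeDecay apex_isScalingUniformlyRecurrent
    ParabolicBump.apex_isBackwardSingularPoint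

/-! ### A3 — the recurrence clause is NOT load-bearing; kill criterion -/

/-- A Type-I singularity model of the Albritton–Barker class (the crux's antecedent minus
recurrence, with a singular origin; a hypothesis-object, not a fact). -/
def TypeISingularProfileExists : Prop :=
  ∃ (u : ℝ → ℝ³ → ℝ³) (p : ℝ → ℝ³ → ℝ) (G : ℝ → ℝ³ → ℝ³ →L[ℝ] ℝ³) (C : ℝ),
    IsSuitableWeakSolutionOn 𝕊 1 0 u p ∧ HasWeakSpatialGradientOn 𝕊 u G ∧
    typeIBound (Set.Iio (0 : ℝ) ×ˢ Set.univ) u p G < ⊤ ∧ HasTypeITimeDecay C u ∧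
    IsBackwardSingularPoint u 0

/-- The crux with the recurrence clause DROPPED. -/
def RecurrentLiouvilleWithoutRecurrence : Prop :=
  ∀ (u : ℝ → ℝ³ → ℝ³) (p : ℝ → ℝ³ → ℝ) (G : ℝ → ℝ³ → ℝ³ →L[ℝ] ℝ³) (C : ℝ),
    IsSuitableWeakSolutionOn 𝕊 1 0 u p → HasWeakSpatialGradientOn 𝕊 u G →
    typeIBound (Set.Iio (0 : ℝ) ×ˢ Set.univ) u p G < ⊤ → HasTypeITimeDecay C u →
    ¬ IsBackwardSingularPoint u 0

/-- It is letter for letter the TARGET of route RecurrentProfiles. -/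
theorem withoutRecurrence_iff_target :
    RecurrentLiouvilleWithoutRecurrence ↔ RecurrentProfiles.NoTypeIRateProfile :=
  Iff.rfl

/-- **A3, KILL CRITERION.** `¬ crux ↔` a Type-I singularity model exists (recurrent or not):
(⇐) via the PROVED `recurrentReduction_proof`; (⇒) forget recurrence.
[cite: AlbrittonBarker2019, Thm. 1.1, Prop. 2.3] -/
theorem recurrentLiouville_false_iff_typeISingularProfileExists :
    ¬ SqueezeCycle.RecurrentLiouville ↔ TypeISingularProfileExists := by
  constructor
  · intro h
    by_contra hne
    refine h fun u p G C hsw hwg hI hdec _ hsing => hne ⟨u, p, G, C, hsw, hwg, hI, hdec, hsing⟩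
  · rintro ⟨u, p, G, C, hsw, hwg, hI, hdec, hsing⟩ hL
    obtain ⟨w, q, H, hsw', hwg', hI', hdec', hsing', hrec'⟩ :=
      recurrentReduction_proof u p G C hsw hwg hI hdec hsing
    exact hL w q H C hsw' hwg' hI' hdec' hrec' hsing'

/-- **A3.** Recurrence is not load-bearing: same counterexamples with or without it. -/
theorem withoutRecurrence_false_iff :
    ¬ RecurrentLiouvilleWithoutRecurrence ↔ ¬ SqueezeCycle.RecurrentLiouville := by
  rw [recurrentLiouville_false_iff_typeISingularProfileExists]
  constructor
  · intro h
    by_contra hne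
    exact h fun u p G C hsw hwg hI hdec hsing => hne ⟨u, p, G, C, hsw, hwg, hI, hdec, hsing⟩
  · rintro ⟨u, p, G, C, hsw, hwg, hI, hdec, hsing⟩ h
    exact h u p G C hsw hwg hI hdec hsing

/-- A Type-I blow-up from rapidly decaying data (the physical object; a hypothesis-object, not a
fact). -/
def TypeIBlowupExists : Prop :=
  ∃ (ν T : ℝ) (u : ℝ → ℝ³ → ℝ³) (p : ℝ → ℝ³ → ℝ), 0 < ν ∧ 0 < T ∧
    IsMaximalSmoothSolution ν 0 u p T ∧ IsLerayHopfOn T ν 0 (u 0) u ∧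
    HasRapidSpatialDecay (u 0) ∧ IsTypeIBlowup u T

/-- **A3, physical form of the kill criterion**: a Type-I blow-up yields a Type-I singularity
model (PROVED item 1591, `typeIBlowupProfile_recurrentProfiles`), hence refutes the crux through
`recurrentLiouville_false_iff_typeISingularProfileExists`. [cite: AlbrittonBarker2019, §3] -/
theorem typeISingularProfileExists_of_typeIBlowup (h : TypeIBlowupExists) :
    TypeISingularProfileExists := by
  obtain ⟨ν, T, u, p, hν, hT, hmax, hLH, hdec, hI⟩ := h
  obtain ⟨w, q, H, C, hsw, hwg, hIb, hrate, hsing⟩ :=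
    typeIBlowupProfile_recurrentProfiles ν T hν hT u p hmax hLH hdec hI
  exact ⟨w, q, H, C, hsw, hwg, hIb, hrate, hsing⟩

/-! ### A4, A5 — clauses not separable this cycle (PROSE; stated for the record) -/

/-- The crux with the RATE dropped: "uniformly recurrent `𝐈 < ⊤` ancient suitable solutions are
regular at the origin". OPEN both ways: no singular suitable weak solution of unforced NS with
`𝐈 < ⊤` is known at all; self-similar ones are excluded without any rate (Tsai 1998 Thm 2, local
energy version, tree `tsai_selfsimilar_local_energy_holds`); the parasitic flow has `𝐈 = ⊤`,
the bump is no solution. No theorem. -/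
def RecurrentLiouvilleWithoutRate : Prop :=
  ∀ (u : ℝ → ℝ³ → ℝ³) (p : ℝ → ℝ³ → ℝ) (G : ℝ → ℝ³ → ℝ³ →L[ℝ] ℝ³),
    IsSuitableWeakSolutionOn 𝕊 1 0 u p → HasWeakSpatialGradientOn 𝕊 u G →
    typeIBound (Set.Iio (0 : ℝ) ×ˢ Set.univ) u p G < ⊤ →
    IsScalingUniformlyRecurrent u → ¬ IsBackwardSingularPoint u 0

/-- The crux with `HasWeakSpatialGradientOn` dropped (`G` decoupled from `u`: only the `E`-term
of `𝐈` is freed, `A`, `C`, `D` still constrain `(u, p)`). Not separable by the known witnesses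
(parasitic: `A = ⊤` on every `Q((0,x₀),r)`; bump: no solution). No theorem. -/
def RecurrentLiouvilleWithoutWeakGradient : Prop :=
  ∀ (u : ℝ → ℝ³ → ℝ³) (p : ℝ → ℝ³ → ℝ) (G : ℝ → ℝ³ → ℝ³ →L[ℝ] ℝ³) (C : ℝ),
    IsSuitableWeakSolutionOn 𝕊 1 0 u p →
    typeIBound (Set.Iio (0 : ℝ) ×ˢ Set.univ) u p G < ⊤ → HasTypeITimeDecay C u →
    IsScalingUniformlyRecurrent u → ¬ IsBackwardSingularPoint u 0

/-! ## §B Settled regimes a counterexample must avoid -/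

/-- Points of the backward cylinder `Q(0, r)` have negative time. [folklore] -/
theorem fst_neg_of_mem_parabolicCylinder_zero {r : ℝ} {z : ℝ × ℝ³}
    (hz : z ∈ parabolicCylinder r (0 : ℝ × ℝ³)) : z.1 < 0 := by
  rw [mem_parabolicCylinder] at hz
  simpa using hz.1.2

/-- **B1.** `C ≤ 0` is trivial: the rate forces `u = 0` on `t < 0`, so the origin is regular
(`‖u‖_{L^∞(Q(0,1))} = 0 ≠ ∞`). WLOG `C > 0` for both sides. [folklore] -/
theorem regular_of_rate_nonpos {C : ℝ} (hC : C ≤ 0) {u : ℝ → ℝ³ → ℝ³} (hdec : HasTypeITimeDecay C u) :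
    ¬ IsBackwardSingularPoint u 0 := by
  intro hsing
  have h0 : ∀ t < 0, ∀ x, u t x = 0 := fun t ht x => by
    have h1 : ‖u t x‖ ≤ 0 :=
      (hdec t ht x).trans (div_nonpos_of_nonpos_of_nonneg hC (Real.sqrt_nonneg _))
    exact norm_le_zero_iff.1 h1
  have hae : (uncurry u) =ᵐ[volume.restrict (parabolicCylinder 1 (0 : ℝ × ℝ³))] 0 := by
    refine (ae_restrict_iff' (isOpen_parabolicCylinder _ _).measurableSet).2 (ae_of_all _ ?_)
    intro z hz
    exact h0 z.1 (fst_neg_of_mem_parabolicCylinder_zero hz) z.2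
  have h := hsing 1 one_pos
  rw [eLpNorm_congr_ae hae, eLpNorm_zero] at h
  exact ENNReal.zero_ne_top h

/-- **B2. Small-rate regime** (ε-regularity in rate form, tree `stub_smallRateRegularity`,
Albritton–Barker 2019 Lemma 2.2 + Prop 2.3): for every `I < ⊤` there is `η > 0` such that the
crux holds — WITHOUT recurrence — for all class profiles with `𝐈 ≤ I` and rate constant `C ≤ η`.
A counterexample must have `C > η(𝐈(u))`. [cite: AlbrittonBarker2019, Lemma 2.2, Prop. 2.3] -/
theorem smallRate_regime :
    ∀ I : ℝ≥0∞, I < ⊤ → ∃ η : ℝ, 0 < η ∧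
      ∀ (u : ℝ → ℝ³ → ℝ³) (p : ℝ → ℝ³ → ℝ) (G : ℝ → ℝ³ → ℝ³ →L[ℝ] ℝ³) (C : ℝ),
        IsSuitableWeakSolutionOn 𝕊 1 0 u p → HasWeakSpatialGradientOn 𝕊 u G →
        typeIBound (Set.Iio (0 : ℝ) ×ˢ Set.univ) u p G ≤ I → HasTypeITimeDecay C u → C ≤ η →
        ¬ IsBackwardSingularPoint u 0 := by
  intro I hI
  obtain ⟨η, hη, H⟩ := RellichScarApexLocalisation.stub_smallRateRegularity I hI
  refine ⟨η, hη, fun u p G C hsw hwg hIle hdec hCη => H u p G hsw hwg hIle ?_⟩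
  refine (ae_restrict_iff' (isOpen_parabolicCylinder _ _).measurableSet).2 (ae_of_all _ ?_)
  intro z hz
  have ht : z.1 < 0 := fst_neg_of_mem_parabolicCylinder_zero hz
  exact (hdec z.1 ht z.2).trans (div_le_div_of_nonneg_right hCη (Real.sqrt_nonneg _))

/-- **B2′. Universal small-rate floor (Leray's lower blow-up-rate bound, ancient class form).**
There is a UNIVERSAL `ε > 0` (independent of `𝐈`) such that every member of the crux's class
(suitable weak on the slab, `𝐈 < ⊤`, rate `C/√(−t)`) with `C ≤ ε` vanishes a.e. on the slab:
Albritton–Barker's continuous Oseen-mild representative (`exists_oseenMild_repr_of_typeIBound_lt_top`)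
is a Type-I KNSS-mild ancient field (`isTypeIAncientMild_of_continuous_oseenMild`) and those vanish
for small constants (`exists_typeIAncientMild_eq_zero_of_small`, the halving argument on the
Duhamel formula). Sharpens B2 (`η(𝐈)`) in the RATE direction; no weak-gradient hypothesis needed.
[cite: Leray1934, (3.9); KochNadirashviliSereginSverak2009, §4 p. 8; AlbrittonBarker2019, Thm. 1.1] -/
theorem exists_universal_rate_floor_ae_zero :
    ∃ ε : ℝ, 0 < ε ∧ ∀ (u : ℝ → ℝ³ → ℝ³) (p : ℝ → ℝ³ → ℝ) (G : ℝ → ℝ³ → ℝ³ →L[ℝ] ℝ³) (C : ℝ),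
      IsSuitableWeakSolutionOn 𝕊 1 0 u p →
      typeIBound (Set.Iio (0 : ℝ) ×ˢ Set.univ) u p G < ⊤ → HasTypeITimeDecay C u → C ≤ ε →
      ∀ᵐ z ∂(volume.restrict (Iio (0 : ℝ) ×ˢ (univ : Set ℝ³))), uncurry u z = 0 := by
  obtain ⟨ε, hε, hsmall⟩ := exists_typeIAncientMild_eq_zero_of_small
  refine ⟨ε, hε, fun u p G C hsw hI hdec hCε => ?_⟩
  obtain ⟨v, hae, hcont, hdiv, hmild, hrate⟩ := exists_oseenMild_repr_of_typeIBound_lt_top hsw hdec hI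
  have hv : IsTypeIAncientMild C v := isTypeIAncientMild_of_continuous_oseenMild hcont hdiv hmild hrate
  have hv0 : ∀ t < 0, ∀ x, v t x = 0 := hsmall C v hv hCε
  filter_upwards [hae, ae_restrict_mem (measurableSet_Iio.prod MeasurableSet.univ)] with z hz hmem
  rw [hz]
  exact hv0 z.1 (by simpa using hmem.1) z.2

/-- **B2′, counterexample form**: a UNIVERSAL floor on the rate constant of any counterexample —
every Type-I singularity model of the class has `C > ε`, whatever its `𝐈`-level. (By scale
invariance of both `C` and `𝐈`, neither can be normalised away.)
[cite: Leray1934, (3.9); AlbrittonBarker2019, Thm. 1.1] -/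
theorem exists_universal_rate_floor :
    ∃ ε : ℝ, 0 < ε ∧ ∀ (u : ℝ → ℝ³ → ℝ³) (p : ℝ → ℝ³ → ℝ) (G : ℝ → ℝ³ → ℝ³ →L[ℝ] ℝ³) (C : ℝ),
      IsSuitableWeakSolutionOn 𝕊 1 0 u p →
      typeIBound (Set.Iio (0 : ℝ) ×ˢ Set.univ) u p G < ⊤ → HasTypeITimeDecay C u →
      IsBackwardSingularPoint u 0 → ε < C := by
  obtain ⟨ε, hε, H⟩ := exists_universal_rate_floor_ae_zero
  refine ⟨ε, hε, fun u p G C hsw hI hdec hsing => ?_⟩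
  by_contra hle
  push Not at hle
  have hae : (uncurry u) =ᵐ[volume.restrict (parabolicCylinder 1 (0 : ℝ × ℝ³))] 0 :=
    ae_restrict_of_ae_restrict_of_subset (parabolicCylinder_origin_subset_slab 1) (H u p G C hsw hI hdec hle)
  have h := hsing 1 one_pos
  rw [eLpNorm_congr_ae hae, eLpNorm_zero] at h
  exact ENNReal.zero_ne_top h

/-! ## §C Natural strengthenings — see the module docstring (PROSE, nothing typed this cycle). -/

/-! ## §D Barriers -/

/-- **The Navier–Stokes INEQUALITY version of the crux's class** (Scheffer 1985; Ożański 2020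
Def. 1.1, localised to the slab in the vocabulary of `IsSuitableWeakSolutionOn`): every clause of
`IsSuitableWeakSolutionOn 𝕊 1 0 u p` EXCEPT the momentum equation in `𝒟'` — local integrability,
weak incompressibility, the local classes `u ∈ L^∞_t L²_x`, `p ∈ L^{3/2}`, `∇u ∈ L²`, and the local
energy INEQUALITY written with the weak gradient `G`. -/
structure IsNSIProfileOnSlab (u : ℝ → ℝ³ → ℝ³) (p : ℝ → ℝ³ → ℝ) (G : ℝ → ℝ³ → ℝ³ →L[ℝ] ℝ³) :
    Prop where
  /-- `u`, `|u|²`, `p` locally integrable on the slab. -/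
  locInt : LocallyIntegrableOn (uncurry u) ((𝕊 : Opens (ℝ × ℝ³)) : Set (ℝ × ℝ³)) volume ∧
    LocallyIntegrableOn (fun z => ‖uncurry u z‖ ^ 2) ((𝕊 : Opens (ℝ × ℝ³)) : Set (ℝ × ℝ³)) volume ∧
    LocallyIntegrableOn (uncurry p) ((𝕊 : Opens (ℝ × ℝ³)) : Set (ℝ × ℝ³)) volume
  /-- `div u = 0` in `𝒟'(𝕊)`. -/
  divFree : ∀ θ : ℝ → ℝ³ → ℝ, IsSpaceTimeTestOn 𝕊 θ →
    ∫ z in ((𝕊 : Opens (ℝ × ℝ³)) : Set (ℝ × ℝ³)), ⟪u z.1 z.2, gradient (θ z.1) z.2⟫ = 0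
  /-- `u ∈ L^∞_t L²_x` on compact subsets. -/
  energyClass : ∀ K ⊆ ((𝕊 : Opens (ℝ × ℝ³)) : Set (ℝ × ℝ³)), IsCompact K → ∃ C : ℝ≥0, ∀ᵐ t : ℝ,
    ∫⁻ x, K.indicator (fun z : ℝ × ℝ³ => ‖u z.1 z.2‖ₑ ^ 2) (t, x) ≤ C
  /-- `p ∈ L^{3/2}` on compact subsets. -/
  pressure : ∀ K ⊆ ((𝕊 : Opens (ℝ × ℝ³)) : Set (ℝ × ℝ³)), IsCompact K →
    ∫⁻ z in K, ‖p z.1 z.2‖ₑ ^ (3 / 2 : ℝ) < ∞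
  /-- `G` is a weak spatial gradient of `u`, square integrable on compact subsets. -/
  weakGrad : HasWeakSpatialGradientOn 𝕊 u G ∧
    ∀ K ⊆ ((𝕊 : Opens (ℝ × ℝ³)) : Set (ℝ × ℝ³)), IsCompact K →
      ∫⁻ z in K, ENNReal.ofReal (frobeniusNormSq (G z.1 z.2)) < ∞
  /-- The local energy INEQUALITY (`ν = 1`, no force term: `f·u ≤ 0` absorbed). -/
  localEnergy : ∀ φ : ℝ → ℝ³ → ℝ, IsSpaceTimeTestOn 𝕊 φ → (∀ t x, 0 ≤ φ t x) →
    2 * 1 * ∫ t, ∫ x, frobeniusNormSq (G t x) * φ t x ≤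
      ∫ t, ∫ x, (‖u t x‖ ^ 2 * (timeDeriv φ t x + 1 * Δ (φ t) x) +
        (‖u t x‖ ^ 2 + 2 * p t x) * ⟪u t x, gradient (φ t) x⟫)

/-- A suitable weak solution of the EQUATIONS on the slab (with its weak gradient) is an NSI
profile: the NSI class contains the crux's class. [cite: CaffarelliKohnNirenberg1982, §2] -/
theorem IsNSIProfileOnSlab.of_suitable {u : ℝ → ℝ³ → ℝ³} {p : ℝ → ℝ³ → ℝ}
    {G : ℝ → ℝ³ → ℝ³ →L[ℝ] ℝ³} (hsw : IsSuitableWeakSolutionOn 𝕊 1 0 u p)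
    (hwg : HasWeakSpatialGradientOn 𝕊 u G)
    (hGL2 : ∀ K ⊆ ((𝕊 : Opens (ℝ × ℝ³)) : Set (ℝ × ℝ³)), IsCompact K →
      ∫⁻ z in K, ENNReal.ofReal (frobeniusNormSq (G z.1 z.2)) < ∞)
    (hLEI : ∀ φ : ℝ → ℝ³ → ℝ, IsSpaceTimeTestOn 𝕊 φ → (∀ t x, 0 ≤ φ t x) →
      2 * 1 * ∫ t, ∫ x, frobeniusNormSq (G t x) * φ t x ≤
        ∫ t, ∫ x, (‖u t x‖ ^ 2 * (timeDeriv φ t x + 1 * Δ (φ t) x) +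
          (‖u t x‖ ^ 2 + 2 * p t x) * ⟪u t x, gradient (φ t) x⟫)) :
    IsNSIProfileOnSlab u p G where
  locInt := ⟨hsw.distributional.1, hsw.distributional.2.1, hsw.distributional.2.2.1⟩
  divFree := hsw.distributional.2.2.2.1
  energyClass := hsw.energyClass
  pressure := hsw.pressure
  weakGrad := ⟨hwg, hGL2⟩
  localEnergy := hLEI

/-- **D1 — the NSI version of the crux** ("LEI-only" statement): uniformly recurrent NSI profiles
on the slab with `𝐈 < ⊤` and the Type-I rate are regular at the origin. CONJECTURALLY FALSE
(barrier, PROSE): the two-sided (`j ∈ ℤ`) Scheffer glue of the tree's NSI block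
(`NSIBlockExists_holds`; one-sided glue: `IsNSIBlock.isWeakNSISolution_glue`, Type-I rates
`norm_glue_le_div_sqrt` / `norm_sub_mul_norm_glue_le`, singular apex `not_isRegularPoint_glue`),
translated to put its apex at the origin, is formally an ancient `τ`-DSS (periodic orbit of the
scaling flow ⇒ uniformly recurrent) origin-singular NSI profile with the rate and `𝐈 < ⊤`. If so,
NO proof of the crux can use of the solution only the clauses of `IsNSIProfileOnSlab` + `𝐈` + rate
+ recurrence; the momentum equation itself must enter (vorticity transport / backward uniqueness /
local energy EQUALITY / the `∂ₛP` coupling of the head pressure). Not formalised this cycle (the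
`ℤ`-glue and its `𝐈` bound are days of Lean); stated so that provers can test a lever against it:
a lever that would also prove `RecurrentLiouvilleForNSI` is suspect. -/
def RecurrentLiouvilleForNSI : Prop :=
  ∀ (u : ℝ → ℝ³ → ℝ³) (p : ℝ → ℝ³ → ℝ) (G : ℝ → ℝ³ → ℝ³ →L[ℝ] ℝ³) (C : ℝ),
    IsNSIProfileOnSlab u p G → typeIBound (Set.Iio (0 : ℝ) ×ˢ Set.univ) u p G < ⊤ →
    HasTypeITimeDecay C u → IsScalingUniformlyRecurrent u → ¬ IsBackwardSingularPoint u 0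

/-! ## §E Line Sketch (rung-neighbourhoods) — targets -/

/-- The "δ-small scaling hulls are removable in `𝒮(C,M)`" property, exactly as it appears (as a
hypothesis) inside the registered stub `stub_rlResidualCore` and (as the conclusion, behind
`∃ δ > 0`) in `stub_rlSmallHullRemoval`. -/
def SmallHullsRemovable (C : ℝ) (M : ℝ≥0∞) (δ : ℝ) : Prop :=
  ∀ (v : ℝ → ℝ³ → ℝ³) (q : ℝ → ℝ³ → ℝ) (H : ℝ → ℝ³ → ℝ³ →L[ℝ] ℝ³),
    IsSuitableWeakSolutionOn 𝕊 1 0 v q → HasWeakSpatialGradientOn 𝕊 v H →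
    typeIBound (Iio (0 : ℝ) ×ˢ univ) v q H ≤ M → HasTypeITimeDecay C v →
    (∀ σ : ℝ, eLpNorm (uncurry (nsRescale (Real.exp σ) v) - uncurry v) 3 μ₁ ≤ ENNReal.ofReal δ) →
    ¬ IsBackwardSingularPoint v 0

/-- Verbatim content of the registered stub `stub_rlSmallHullRemoval` (Branch A; p117043). -/
def SmallHullRemovalStmt : Prop :=
  ∀ (C : ℝ) (M : ℝ≥0∞), M < ⊤ → ∃ δ : ℝ, 0 < δ ∧ SmallHullsRemovable C M δ

/-- Verbatim content of the registered stub `stub_rlResidualCore` (S5, the lead's STUCK stub). -/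
def ResidualCoreStmt : Prop :=
  ∀ (C : ℝ) (M : ℝ≥0∞) (δ : ℝ), M < ⊤ → 0 < δ → SmallHullsRemovable C M δ →
    ∀ (u : ℝ → ℝ³ → ℝ³) (p : ℝ → ℝ³ → ℝ) (G : ℝ → ℝ³ → ℝ³ →L[ℝ] ℝ³),
      IsSuitableWeakSolutionOn 𝕊 1 0 u p → HasWeakSpatialGradientOn 𝕊 u G →
      typeIBound (Iio (0 : ℝ) ×ˢ univ) u p G ≤ M → HasTypeITimeDecay C u →
      IsScalingUniformlyRecurrent u →
      (∃ σ : ℝ, ENNReal.ofReal δ < eLpNorm (uncurry (nsRescale (Real.exp σ) u) - uncurry u) 3 μ₁) →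
      ¬ IsBackwardSingularPoint u 0

/-- Sanity: `ResidualCoreStmt` is the registered signature (same binder types and order; the
abbreviation `SmallHullsRemovable` unfolds to the inline hypothesis). -/
example : ResidualCoreStmt ↔
    ∀ (C : ℝ) (M : ℝ≥0∞) (δ : ℝ), M < ⊤ → 0 < δ → (∀ (v : ℝ → EuclideanSpace ℝ (Fin 3) → EuclideanSpace ℝ (Fin 3)) (q : ℝ → EuclideanSpace ℝ (Fin 3) → ℝ) (H : ℝ → EuclideanSpace ℝ (Fin 3) → EuclideanSpace ℝ (Fin 3) →L[ℝ] EuclideanSpace ℝ (Fin 3)), IsSuitableWeakSolutionOn (slab (EuclideanSpace ℝ (Fin 3)) (Iio 0) isOpen_Iio) 1 0 v q → HasWeakSpatialGradientOn (slab (EuclideanSpace ℝ (Fin 3)) (Iio 0) isOpen_Iio) v H → typeIBound (Iio (0 : ℝ) ×ˢ univ) v q H ≤ M → HasTypeITimeDecay C v → (∀ σ : ℝ, eLpNorm (uncurry (nsRescale (Real.exp σ) v) - uncurry v) 3 (volume.restrict (parabolicCylinder 1 (0 : ℝ × EuclideanSpace ℝ (Fin 3)))) ≤ ENNReal.ofReal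 δ) → ¬ IsBackwardSingularPoint v 0) → ∀ (u : ℝ → EuclideanSpace ℝ (Fin 3) → EuclideanSpace ℝ (Fin 3)) (p : ℝ → EuclideanSpace ℝ (Fin 3) → ℝ) (G : ℝ → EuclideanSpace ℝ (Fin 3) → EuclideanSpace ℝ (Fin 3) →L[ℝ] EuclideanSpace ℝ (Fin 3)), IsSuitableWeakSolutionOn (slab (EuclideanSpace ℝ (Fin 3)) (Iio 0) isOpen_Iio) 1 0 u p → HasWeakSpatialGradientOn (slab (EuclideanSpace ℝ (Fin 3)) (Iio 0) isOpen_Iio) u G → typeIBound (Iio (0 : ℝ) ×ˢ univ) u p G ≤ M → HasTypeITimeDecay C u → IsScalingUniformlyRecurrent u → (∃ σ : ℝ, ENNReal.ofReal δ < eLpNorm (uncurry (nsRescale (Real.exp σ) u) - uncurry u) 3 (volume.restrict (parabolicCylinder 1 (0 : ℝ × EuclideanSpace ℝ (Fin 3))))) → ¬ IsBackwardSingularPoint u 0 :=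
  Iff.rfl

/-- (←, trivial) the crux implies the residual core outright — S5 is a SPECIAL CASE of the crux
(it only adds hypotheses: `𝐈 ≤ M < ⊤`, non-small orbit). -/
theorem residualCore_of_crux (h : SqueezeCycle.RecurrentLiouville) : ResidualCoreStmt :=
  fun C _M _δ hM _hδ _hR u p G hsw hwg hI hdec hrec _hσ =>
    h u p G C hsw hwg (lt_of_le_of_lt hI hM) hdec hrec

/-- (→) **S5 is crux-complete modulo Branch A**: given small-hull removal, a Type-I singularity
model refutes the residual core. Proof: make the model recurrent (`recurrentReduction_proof`,
item 1590, PROVED), take `M := 𝐈(w)`, `δ := δ(C, M)` from small-hull removal; the recurrent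
singular `w` cannot have a `δ`-small orbit (it would be regular), so it satisfies every
hypothesis of S5, whose conclusion it violates. [cite: AlbrittonBarker2019, Thm. 1.1] -/
theorem not_residualCore_of_typeISingularProfileExists (hSHR : SmallHullRemovalStmt)
    (h : TypeISingularProfileExists) : ¬ ResidualCoreStmt := by
  rintro hS5
  obtain ⟨u, p, G, C, hsw, hwg, hI, hdec, hsing⟩ := h
  obtain ⟨w, q, H, hsw', hwg', hI', hdec', hsing', hrec'⟩ :=
    recurrentReduction_proof u p G C hsw hwg hI hdec hsing
  obtain ⟨δ, hδ, hR⟩ := hSHR C (typeIBound (Iio (0 : ℝ) ×ˢ univ) w q H) hI'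
  have hσ : ∃ σ : ℝ, ENNReal.ofReal δ <
      eLpNorm (uncurry (nsRescale (Real.exp σ) w) - uncurry w) 3 μ₁ := by
    by_contra hno
    push Not at hno
    exact hR w q H hsw' hwg' le_rfl hdec' hno hsing'
  exact hS5 C _ δ hI' hδ hR w q H hsw' hwg' le_rfl hdec' hrec' hσ hsing'

/-- **E1. The residual core IS the crux (modulo Branch A).** `¬ S5 ↔ ¬ RecurrentLiouville ↔` a
Type-I singularity model exists. So S5 is not a reduction of the crux but a restatement: no
lever of line Sketch touches it, and a kill of S5 is a kill of the crux (an explicit Type-I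
singularity model), nothing cheaper. [cite: AlbrittonBarker2019, Thm. 1.1] -/
theorem residualCore_false_iff (hSHR : SmallHullRemovalStmt) :
    ¬ ResidualCoreStmt ↔ ¬ SqueezeCycle.RecurrentLiouville := by
  rw [recurrentLiouville_false_iff_typeISingularProfileExists]
  refine ⟨fun h => ?_, not_residualCore_of_typeISingularProfileExists hSHR⟩
  by_contra hne
  exact h (residualCore_of_crux fun u p G C hsw hwg hI hdec _ hsing =>
    (hne ⟨u, p, G, C, hsw, hwg, hI, hdec, hsing⟩).elim)

/-- Branch A is now the landed theorem `stub_rlSmallHullRemoval` (p117043, ACCEPTED). -/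
theorem smallHullRemovalStmt_holds : SmallHullRemovalStmt := fun C M hM => stub_rlSmallHullRemoval C M hM

/-- **E1, unconditional.** `¬ S5 ↔ ¬ crux`: the STUCK stub carries the whole crux. LANDED:
`RecurrentLiouville.Negative.residualCore_false_iff` (p119748, ACCEPTED) and its unconditional
corollary `residualCore_false_iff_recurrentLiouville_false` (p120057, ACCEPTED).
[cite: AlbrittonBarker2019, Thm. 1.1] -/
theorem residualCore_false_iff_crux_false : ¬ ResidualCoreStmt ↔ ¬ SqueezeCycle.RecurrentLiouville :=
  residualCore_false_iff smallHullRemovalStmt_holds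

/-! ### E2 — load-bearing hypotheses of the Branch lemmas (junk witnesses) -/

/-- Orbit differences of an exactly self-similar field vanish identically. [folklore] -/
theorem orbitDiff_eq_zero_of_nsRescale_eq {u : ℝ → ℝ³ → ℝ³} {c : ℝ} (h : nsRescale c u = u) :
    uncurry (nsRescale c u) - uncurry u = 0 := by
  rw [h, sub_self]

/-- **E2a. `M < ⊤` (i.e. `𝐈 ≤ M < ⊤`) is load-bearing in `stub_rlSmallHullRemoval`**: at `M = ⊤`
small-hull removal is false for every `δ` — the parasitic slab flow has orbit diameter `0`
(exactly self-similar), is a suitable weak solution with the rate, and is origin-singular.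
[cite: KNSS2009, §1 (1.4)] -/
theorem smallHullsRemovable_top_false (δ : ℝ) : ¬ SmallHullsRemovable 1 ⊤ δ := fun h =>
  h _ _ _ (parasitic_isSuitableWeakSolutionOn 1) (parasitic_hasWeakSpatialGradientOn 1) le_top
    (parasitic_hasTypeITimeDecay zero_le_one)
    (fun σ => by
      rw [orbitDiff_eq_zero_of_nsRescale_eq (parasitic_nsRescale 1 (Real.exp_pos σ)), eLpNorm_zero]
      exact bot_le)
    (parasitic_isBackwardSingularPoint_zero one_pos)

/-- Hence the `M < ⊤`-free version of Branch A is false. [cite: KNSS2009, §1 (1.4)] -/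
theorem smallHullRemoval_false_without_finiteBound :
    ¬ ∀ (C : ℝ) (M : ℝ≥0∞), ∃ δ : ℝ, 0 < δ ∧ SmallHullsRemovable C M δ := fun h => by
  obtain ⟨δ, _, hR⟩ := h 1 ⊤
  exact smallHullsRemovable_top_false δ hR

/-- **E2b. `M < ⊤` is load-bearing in `stub_rlNearIdentityDSS`** (Branch A′, ACCEPTED p118437):
the parasitic flow is `λ`-DSS for EVERY `λ`, so without `𝐈 ≤ M < ⊤` near-identity DSS
exclusion fails for every window `(1, Λ)`. [cite: KNSS2009, §1 (1.4)] -/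
theorem nearIdentityDSS_false_without_finiteBound :
    ¬ ∀ (C : ℝ) (M : ℝ≥0∞), ∃ Λ : ℝ, 1 < Λ ∧ ∀ (lam : ℝ), 1 < lam → lam < Λ →
        ∀ (u : ℝ → ℝ³ → ℝ³) (p : ℝ → ℝ³ → ℝ) (G : ℝ → ℝ³ → ℝ³ →L[ℝ] ℝ³),
          IsSuitableWeakSolutionOn 𝕊 1 0 u p → HasWeakSpatialGradientOn 𝕊 u G →
          typeIBound (Iio (0 : ℝ) ×ˢ univ) u p G ≤ M → HasTypeITimeDecay C u →
          (∀ᵐ z ∂(volume.restrict (Iio (0 : ℝ) ×ˢ (univ : Set ℝ³))), nsRescale lam u z.1 z.2 = u z.1 z.2) →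
          ¬ IsBackwardSingularPoint u 0 := fun h => by
  obtain ⟨Λ, hΛ, H⟩ := h 1 ⊤
  have h1 : (1 : ℝ) < (1 + Λ) / 2 := by linarith
  have h2 : (1 + Λ) / 2 < Λ := by linarith
  refine H _ h1 h2 _ _ _ (parasitic_isSuitableWeakSolutionOn 1) (parasitic_hasWeakSpatialGradientOn 1)
    le_top (parasitic_hasTypeITimeDecay zero_le_one) (ae_of_all _ fun z => ?_)
    (parasitic_isBackwardSingularPoint_zero one_pos)
  rw [parasitic_nsRescale 1 (by linarith)]

/-- **E2c. The equations are load-bearing in Branch A**: with `IsSuitableWeakSolutionOn` dropped,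
small-hull removal fails at the FINITE level `M = 𝐈(bump) < ⊤` — the kinematic bump is exactly
self-similar (orbit diameter `0`), has weak gradient, `𝐈 < ⊤`, the rate, and is origin-singular.
[cite: AlbrittonBarker2019, §1] -/
theorem smallHullRemoval_false_without_navierStokes :
    ¬ ∀ (C : ℝ) (M : ℝ≥0∞), M < ⊤ → ∃ δ : ℝ, 0 < δ ∧
        ∀ (v : ℝ → ℝ³ → ℝ³) (q : ℝ → ℝ³ → ℝ) (H : ℝ → ℝ³ → ℝ³ →L[ℝ] ℝ³),
          HasWeakSpatialGradientOn 𝕊 v H →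
          typeIBound (Iio (0 : ℝ) ×ˢ univ) v q H ≤ M → HasTypeITimeDecay C v →
          (∀ σ : ℝ, eLpNorm (uncurry (nsRescale (Real.exp σ) v) - uncurry v) 3 μ₁ ≤ ENNReal.ofReal δ) →
          ¬ IsBackwardSingularPoint v 0 := fun h => by
  obtain ⟨δ, _, hR⟩ := h 1 _ ParabolicBump.typeIBound_apex_lt_top
  refine hR _ 0 _ ParabolicBump.apex_hasWeakSpatialGradientOn le_rfl ParabolicBump.apex_hasTypeITimeDecay
    (fun σ => ?_) ParabolicBump.apex_isBackwardSingularPoint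
  rw [orbitDiff_eq_zero_of_nsRescale_eq
    (RecurrentLiouville.Negative.apex_nsRescale (Real.exp_pos σ)), eLpNorm_zero]
  exact bot_le

/-! ## §F Portrait of a counterexample (every clause a PROVED exclusion) -/

/-- **F. What a counterexample must look like.** If `(u, p, G, C)` is a Type-I singularity model
of the Albritton–Barker class (= a counterexample to the crux with recurrence forgotten, §A3),
then, by theorems ALREADY IN THE TREE:
1. `C > ε` for a UNIVERSAL `ε > 0` (B2′: Leray's lower blow-up-rate bound in ancient class
   form; independent of `𝐈(u)`, and neither `C` nor `𝐈` can be normalised, both being scale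
   invariant);
2. `u` is not a.e. `λ`-DSS on the slab for any `λ` in a window `(1, Λ(C, 𝐈(u)))` — in particular
   not self-similar (Branch A′ `stub_rlNearIdentityDSS`, ACCEPTED: Tsai's rung made open);
3. `u` is not `δ(C, 𝐈(u))`-close in `L³(Q(0,2))` to ANY field with axisymmetric slices
   (Branch C `stub_rlNearAxisymmetricRemoval`, ACCEPTED: the Seregin–Šverák rung made open);
4. `u` has a uniformly recurrent singular sibling in the same class with the same rate
   (`recurrentReduction_proof`): minimal sets of the scaling flow carry counterexamples too.
Items 2–3 are the whole harvest of line Sketch; item 5 (orbit diameter `> δ(C, 𝐈(u))` in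
`L³(Q(0,1))`) is `orbit_not_small_of_singular` below, modulo Branch A.
[cite: AlbrittonBarker2019, Thm. 1.1, Lemma 2.2, Prop. 2.3; Tsai1998, Thm. 1; SereginSverak2009, Thm. 1.1] -/
theorem counterexample_portrait {u : ℝ → ℝ³ → ℝ³} {p : ℝ → ℝ³ → ℝ} {G : ℝ → ℝ³ → ℝ³ →L[ℝ] ℝ³}
    {C : ℝ} (hsw : IsSuitableWeakSolutionOn 𝕊 1 0 u p) (hwg : HasWeakSpatialGradientOn 𝕊 u G)
    (hI : typeIBound (Set.Iio (0 : ℝ) ×ˢ Set.univ) u p G < ⊤) (hdec : HasTypeITimeDecay C u)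
    (hsing : IsBackwardSingularPoint u 0) :
    (∃ ε : ℝ, 0 < ε ∧ ε < C ∧
      ∀ (v : ℝ → ℝ³ → ℝ³) (q : ℝ → ℝ³ → ℝ) (H : ℝ → ℝ³ → ℝ³ →L[ℝ] ℝ³) (C' : ℝ),
        IsSuitableWeakSolutionOn 𝕊 1 0 v q → typeIBound (Iio (0 : ℝ) ×ˢ univ) v q H < ⊤ →
        HasTypeITimeDecay C' v → IsBackwardSingularPoint v 0 → ε < C') ∧
    (∃ Λ : ℝ, 1 < Λ ∧ ∀ lam : ℝ, 1 < lam → lam < Λ →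
      ¬ ∀ᵐ z ∂(volume.restrict (Iio (0 : ℝ) ×ˢ (univ : Set ℝ³))), nsRescale lam u z.1 z.2 = u z.1 z.2) ∧
    (∃ δ : ℝ, 0 < δ ∧ ∀ a : ℝ → ℝ³ → ℝ³, (∀ t : ℝ, IsAxisymmetric (a t)) →
      AEStronglyMeasurable (uncurry a) μ₂ → ENNReal.ofReal δ < eLpNorm (uncurry u - uncurry a) 3 μ₂) ∧
    (∃ (w : ℝ → ℝ³ → ℝ³) (q : ℝ → ℝ³ → ℝ) (H : ℝ → ℝ³ → ℝ³ →L[ℝ] ℝ³),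
      IsSuitableWeakSolutionOn 𝕊 1 0 w q ∧ HasWeakSpatialGradientOn 𝕊 w H ∧
      typeIBound (Set.Iio (0 : ℝ) ×ˢ Set.univ) w q H < ⊤ ∧ HasTypeITimeDecay C w ∧
      IsBackwardSingularPoint w 0 ∧ IsScalingUniformlyRecurrent w) := by
  refine ⟨?_, ?_, ?_, ?_⟩
  · -- B2′: the universal rate floor
    obtain ⟨ε, hε, H⟩ := exists_universal_rate_floor
    exact ⟨ε, hε, H u p G C hsw hI hdec hsing, H⟩
  · -- Branch A′
    obtain ⟨Λ, hΛ, H⟩ := stub_rlNearIdentityDSS C _ hI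
    exact ⟨Λ, hΛ, fun lam h1 h2 hdss => H lam h1 h2 u p G hsw hwg le_rfl hdec hdss hsing⟩
  · -- Branch C
    obtain ⟨δ, hδ, H⟩ := stub_rlNearAxisymmetricRemoval C _ hI
    refine ⟨δ, hδ, fun a ha hameas => ?_⟩
    by_contra hle
    push Not at hle
    exact H u p G hsw hwg le_rfl hdec ⟨a, ha, hameas, hle⟩ hsing
  · -- reduction to a recurrent sibling
    obtain ⟨w, q, H, hsw', hwg', hI', hdec', hsing', hrec'⟩ :=
      recurrentReduction_proof u p G C hsw hwg hI hdec hsing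
    exact ⟨w, q, H, hsw', hwg', hI', hdec', hsing', hrec'⟩

/-- Item 5 of the portrait, modulo Branch A (`stub_rlSmallHullRemoval`, p117043 — since ACCEPTED, see the primed version): the
scaling orbit of a counterexample has `L³(Q(0,1))`-diameter `> δ(C, 𝐈(u))`. -/
theorem orbit_not_small_of_singular (hSHR : SmallHullRemovalStmt)
    {u : ℝ → ℝ³ → ℝ³} {p : ℝ → ℝ³ → ℝ} {G : ℝ → ℝ³ → ℝ³ →L[ℝ] ℝ³} {C : ℝ}
    (hsw : IsSuitableWeakSolutionOn 𝕊 1 0 u p) (hwg : HasWeakSpatialGradientOn 𝕊 u G)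
    (hI : typeIBound (Set.Iio (0 : ℝ) ×ˢ Set.univ) u p G < ⊤) (hdec : HasTypeITimeDecay C u)
    (hsing : IsBackwardSingularPoint u 0) :
    ∃ δ : ℝ, 0 < δ ∧ ∃ σ : ℝ,
      ENNReal.ofReal δ < eLpNorm (uncurry (nsRescale (Real.exp σ) u) - uncurry u) 3 μ₁ := by
  obtain ⟨δ, hδ, hR⟩ := hSHR C _ hI
  refine ⟨δ, hδ, ?_⟩
  by_contra hno
  push Not at hno
  exact hR u p G hsw hwg le_rfl hdec hno hsing

/-- Item 5 of the portrait, UNCONDITIONAL (Branch A landed): the scaling orbit of any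
counterexample has `L³(Q(0,1))`-diameter `> δ(C, 𝐈(u)) > 0` — a counterexample is quantitatively
NOT almost self-similar at the origin. [cite: AlbrittonBarker2019, Thm. 1.1; Tsai1998, Thm. 1] -/
theorem orbit_not_small_of_singular' {u : ℝ → ℝ³ → ℝ³} {p : ℝ → ℝ³ → ℝ}
    {G : ℝ → ℝ³ → ℝ³ →L[ℝ] ℝ³} {C : ℝ}
    (hsw : IsSuitableWeakSolutionOn 𝕊 1 0 u p) (hwg : HasWeakSpatialGradientOn 𝕊 u G)
    (hI : typeIBound (Set.Iio (0 : ℝ) ×ˢ Set.univ) u p G < ⊤) (hdec : HasTypeITimeDecay C u)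
    (hsing : IsBackwardSingularPoint u 0) :
    ∃ δ : ℝ, 0 < δ ∧ ∃ σ : ℝ,
      ENNReal.ofReal δ < eLpNorm (uncurry (nsRescale (Real.exp σ) u) - uncurry u) 3 μ₁ :=
  orbit_not_small_of_singular smallHullRemovalStmt_holds hsw hwg hI hdec hsing

/-! ## §G Near-misses — none (a kill = an explicit Type-I singularity model; see §F). -/

end Summit.NavierStokesRegularity.NavierStokesRegularity.Cruxes.RecurrentLiouville.Disproof

end
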